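import Mathlib
import Summits.Ventures.PercRepro2.Defs
import Summits.Ventures.PercRepro2.Independence
import Summits.Ventures.PercRepro2.Harris
import Summits.Ventures.PercRepro2.Graph
import Summits.Ventures.PercRepro2.Exploration
import Summits.Ventures.PercRepro2.Events
import Summits.Ventures.PercRepro2.GateCylinder
import Summits.Ventures.PercRepro2.CDRequired
import Summits.Ventures.PercRepro2.CutVertexDefs
import Summits.Ventures.PercRepro2.CDCutVertex
import Summits.Ventures.PercRepro2.CycleConn
import Summits.Ventures.PercRepro2.CDCycle
import Summits.Ventures.PercRepro2.CDCutAC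
import Summits.Ventures.PercRepro2.CDFanPockets
import Summits.Ventures.PercRepro2.CDFanBlocks

/-!
# Row 2′CD on a cycle with arbitrary graphs hanging at all its vertices (blind cell PercRepro2,
mine-a g36; MINE-A.md §91.12)

The cycle theorem of `CDCycle` lives on the model `cycN n` (`V = E = Fin n`).  Here a cycle is EMBEDDED
in an arbitrary graph: vertices `x : Fin n → V` (injective), edges `r : Fin n → E` with
`ends (r i) = s(x i, x (i + 1))`.  For a configuration whose open edges are cycle edges, connections
between cycle vertices are those of the model (`conn_embed_iff`, the closure lemma in both
directions).  If the cycle CARRIES its connections (every connection between two cycle vertices survives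
closing the other edges — true when every other edge lies in a pocket hanging at a single cycle vertex,
`carry_of_cuts` from `CDFanPockets.conn_restrict_of_cuts`), then under `Q = {x i₁ ↮ x i₂}` the event
`{x i₁ ↔ x i₃}` is the cylinder of the arc avoiding `x i₂` (`Q_inter_connEvent_eq_cylinder_embed`, from
`CDCycle.Q_inter_connEvent_eq_cylinder`), and:

* `cd_of_cycle_carried` — `a₁, a₂, a₃` on the cycle, `o` ANYWHERE in the graph, every up-set, every
  admissible weight vector (`CDCycle.cd_of_cylinder_Q` on the whole graph);
* `cd_of_cycle_far` / `cd_of_cycle_root` / `cd_of_cycle_both` — `a₃` and/or `a₁` in arbitrary graphs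
  hanging at their cycle vertices (the (AC) transfers of `CDCutAC`), `a₂` on the cycle, `o` on the near
  side of the cuts used.

The block-cut tree of the placement is a cycle with arbitrary blocks at all its vertices — the second
2-connected family with pockets, after the fan.  No definition; one seat.
-/

namespace Summit.Ventures.PercRepro2

namespace CDCyclePockets

open Cycle Fin.NatCast

section Embed

variable {V : Type*} {E : Type*} {n : ℕ} [NeZero n]

/-- **Connections along an embedded cycle are those of the model `cycN n`**, for a configuration whose
open edges are cycle edges. -/
lemma conn_embed_iff {ends : E → Sym2 V} (x : Fin n → V) (r : Fin n → E)
    (hr : ∀ i, ends (r i) = s(x i, x (i + 1))) (hx : Function.Injective x) {ω : Config E}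
    (hsupp : ∀ e, ω e = true → ∃ k, e = r k) (u v : Fin n) :
    Conn ends ω (x u) (x v) ↔ Conn (cycN n) (ω ∘ r) u v := by
  constructor
  · intro h
    have key := mem_of_conn_of_closed (ends := ends) (ω := ω)
      (S := {w | ∃ i, x i = w ∧ Conn (cycN n) (ω ∘ r) u i}) ?_ ⟨u, rfl, conn_refl _ _ _⟩ h
    · obtain ⟨i, hi, hconn⟩ := key
      rw [hx hi] at hconn
      exact hconn
    · rintro w ⟨i, rfl, hi⟩ w' hadj
      obtain ⟨_, e, he, hends⟩ := openGraph_adj.1 hadj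
      obtain ⟨k, rfl⟩ := hsupp e he
      rw [hr k, Sym2.eq_iff] at hends
      rcases hends with ⟨h1, h2⟩ | ⟨h1, h2⟩
      · have hk : k = i := hx h1
        subst hk
        exact ⟨k + 1, h2, conn_trans hi (conn_of_openAdj ⟨k, he, rfl⟩)⟩
      · have hk : k + 1 = i := hx h2
        subst hk
        exact ⟨k, h1, conn_trans hi (conn_symm (conn_of_openAdj ⟨k, he, rfl⟩))⟩
  · intro h
    have key := mem_of_conn_of_closed (ends := cycN n) (ω := ω ∘ r)
      (S := {i | Conn ends ω (x u) (x i)}) ?_ (conn_refl _ _ _) h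
    · exact key
    · rintro i hi i' hadj
      obtain ⟨_, k, hk, hends⟩ := openGraph_adj.1 hadj
      rw [cycN_apply, Sym2.eq_iff] at hends
      have hopen : OpenAdj ends ω (x i) (x i') := by
        rcases hends with ⟨rfl, rfl⟩ | ⟨rfl, rfl⟩
        · exact ⟨r k, hk, hr k⟩
        · exact ⟨r k, hk, by rw [hr k, Sym2.eq_swap]⟩
      exact conn_trans hi (conn_of_openAdj hopen)

/-- **The cylinder identity on an embedded cycle carrying its connections**: under `Q = {x i₁ ↮ x i₂}`
the event `{x i₁ ↔ x i₃}` is the cylinder of the arc avoiding `x i₂`. -/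
theorem Q_inter_connEvent_eq_cylinder_embed [DecidableEq E] {ends : E → Sym2 V} (x : Fin n → V)
    (r : Fin n → E) (hr : ∀ i, ends (r i) = s(x i, x (i + 1))) (hx : Function.Injective x)
    (EC : Set E) [DecidablePred (· ∈ EC)] (hEC : ∀ e, e ∈ EC → ∃ k, e = r k)
    (hrEC : ∀ k, r k ∈ EC)
    (hcarry : ∀ ω : Config E, ∀ i j : Fin n, Conn ends ω (x i) (x j) →
      Conn ends (restrict EC ω) (x i) (x j)) (i₁ i₂ i₃ : Fin n) :
    (connEvent ends (x i₁) (x i₂))ᶜ ∩ connEvent ends (x i₁) (x i₃) =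
      (connEvent ends (x i₁) (x i₂))ᶜ ∩ GateCylinder.cylinder
        ((if dist i₁ i₃ < dist i₁ i₂ then upInterval i₁ i₃ else upInterval i₃ i₁).image r) := by
  have hconn : ∀ (ω : Config E) (i j : Fin n),
      Conn ends ω (x i) (x j) ↔ Conn (cycN n) (ω ∘ r) i j := by
    intro ω i j
    have hsupp : ∀ e, restrict EC ω e = true → ∃ k, e = r k :=
      fun e he => hEC e (restrict_eq_true_iff.1 he).2
    have hcomp : (restrict EC ω) ∘ r = ω ∘ r := by
      funext k
      simp only [Function.comp_apply]
      exact restrict_apply_of_mem (hrEC k)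
    rw [← hcomp, ← conn_embed_iff x r hr hx hsupp]
    exact ⟨hcarry ω i j, conn_mono (restrict_le EC ω)⟩
  ext ω
  have key := Set.ext_iff.1 (CDCycle.Q_inter_connEvent_eq_cylinder (n := n) i₁ i₂ i₃) (ω ∘ r)
  simp only [Set.mem_inter_iff, Set.mem_compl_iff, mem_connEvent, GateCylinder.cylinder,
    Set.mem_setOf_eq, Finset.mem_image, forall_exists_index, and_imp, forall_apply_eq_imp_iff₂,
    Function.comp_apply] at key ⊢
  rw [hconn ω i₁ i₂, hconn ω i₁ i₃]
  exact key

omit [NeZero n] in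
/-- **A cycle carries its connections when every other edge lies in a pocket at a cycle vertex**: a
family of cuts whose near sides all contain the cycle, with the intersection of the near sides inside
the cycle edges. -/
theorem carry_of_cuts {ends : E → Sym2 V} (x : Fin n → V) (EC : Set E) [DecidablePred (· ∈ EC)]
    (k : ℕ) (z : ℕ → V) (VA VB : ℕ → Set V) (EA EB : ℕ → Set E) [∀ l, DecidablePred (· ∈ EA l)]
    (hcut : ∀ l, l < k → CutV.IsCut ends (z l) (VA l) (VB l) (EA l) (EB l))
    (hx : ∀ l, l < k → ∀ i, x i ∈ VA l ∪ {z l}) (S : Set E) [DecidablePred (· ∈ S)]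
    (hS : ∀ e, e ∈ S ↔ ∀ l, l < k → e ∈ EA l) (hsub : S ⊆ EC) :
    ∀ ω : Config E, ∀ i j : Fin n, Conn ends ω (x i) (x j) → Conn ends (restrict EC ω) (x i) (x j) :=
  fun ω i j h => conn_mono (CDFanPockets.restrict_le_restrict hsub ω)
    (CDFanPockets.conn_restrict_of_cuts k z VA VB EA EB hcut (fun l hl => hx l hl i)
      (fun l hl => hx l hl j) S hS ω h)

end Embed

section Theorems

variable {V : Type*} {E : Type*} [Fintype E] [DecidableEq E] [Fintype V] [DecidableEq V]
  {R : Type*} [Field R] [LinearOrder R] [IsStrictOrderedRing R] {n : ℕ} [NeZero n]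

variable {ends : E → Sym2 V} {VA VB : Set V} {EA EB : Set E} [DecidablePred (· ∈ EA)]
  [DecidablePred (· ∈ EB)]

/-- **Row 2′CD on an embedded cycle carrying its connections**: `a₁ = x i₁`, `a₂ = x i₂`, `a₃ = x i₃` on
the cycle, `o` ANYWHERE, every up-set, every admissible weight vector — whatever hangs at the cycle. -/
theorem cd_of_cycle_carried (p : E → R) (hp : IsProbVec p) (x : Fin n → V) (r : Fin n → E)
    (hr : ∀ i, ends (r i) = s(x i, x (i + 1))) (hx : Function.Injective x) (EC : Set E)
    [DecidablePred (· ∈ EC)] (hEC : ∀ e, e ∈ EC → ∃ k, e = r k) (hrEC : ∀ k, r k ∈ EC)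
    (hcarry : ∀ ω : Config E, ∀ i j : Fin n, Conn ends ω (x i) (x j) →
      Conn ends (restrict EC ω) (x i) (x j)) (i₁ i₂ i₃ : Fin n) (o : V) {𝓔 : Set (Set V)}
    (h𝓔 : IsUpperSet 𝓔) :
    let Q := (connEvent ends (x i₁) (x i₂))ᶜ
    let U := clusterInEvent ends (x i₁) 𝓔
    let e := connEvent ends (x i₁) (x i₃)
    let f := connEvent ends (x i₂) o
    let N := (connEvent ends (x i₁) (x i₃))ᶜ ∩ (connEvent ends (x i₂) (x i₃))ᶜ
    let oU := connEvent ends (x i₁) o ∪ connEvent ends (x i₂) o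
    prob p (Q ∩ N) * (prob p Q * prob p (Q ∩ U ∩ e ∩ f) - prob p (Q ∩ U) * prob p (Q ∩ e ∩ f)) ≤
      prob p (Q ∩ N ∩ oU) * (prob p Q * prob p (Q ∩ U ∩ e) - prob p (Q ∩ U) * prob p (Q ∩ e)) :=
  CDCycle.cd_of_cylinder_Q p hp ends (x i₁) (x i₂) (x i₃) o h𝓔
    (Q_inter_connEvent_eq_cylinder_embed x r hr hx EC hEC hrEC hcarry i₁ i₂ i₃)

/-- **`a₃` in an arbitrary graph hanging at the cycle vertex `x i₃`** (`a₁, a₂` on the cycle, `o` on the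
near side of the cut). -/
theorem cd_of_cycle_far (p : E → R) (hp : IsProbVec p) (x : Fin n → V) (r : Fin n → E)
    (hr : ∀ i, ends (r i) = s(x i, x (i + 1))) (hx : Function.Injective x) (EC : Set E)
    [DecidablePred (· ∈ EC)] (hEC : ∀ e, e ∈ EC → ∃ k, e = r k) (hrEC : ∀ k, r k ∈ EC)
    (hcarry : ∀ ω : Config E, ∀ i j : Fin n, Conn ends ω (x i) (x j) →
      Conn ends (restrict EC ω) (x i) (x j)) (i₁ i₂ i₃ : Fin n)
    (h : CutV.IsCut ends (x i₃) VA VB EA EB) {a₃ o : V} (hi₁ : x i₁ ∈ VA ∪ {x i₃})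
    (hi₂ : x i₂ ∈ VA ∪ {x i₃}) (ho : o ∈ VA ∪ {x i₃}) (ha₃ : a₃ ∈ VB) {𝓔 : Set (Set V)}
    (h𝓔 : IsUpperSet 𝓔) :
    let Q := (connEvent ends (x i₁) (x i₂))ᶜ
    let U := clusterInEvent ends (x i₁) 𝓔
    let e := connEvent ends (x i₁) a₃
    let f := connEvent ends (x i₂) o
    let N := (connEvent ends (x i₁) a₃)ᶜ ∩ (connEvent ends (x i₂) a₃)ᶜ
    let oU := connEvent ends (x i₁) o ∪ connEvent ends (x i₂) o
    prob p (Q ∩ N) * (prob p Q * prob p (Q ∩ U ∩ e ∩ f) - prob p (Q ∩ U) * prob p (Q ∩ e ∩ f)) ≤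
      prob p (Q ∩ N ∩ oU) * (prob p Q * prob p (Q ∩ U ∩ e) - prob p (Q ∩ U) * prob p (Q ∩ e)) :=
  CDFanBlocks.cd_of_cylinder_Q_far p hp h hi₁ hi₂ ho ha₃ h𝓔
    (Q_inter_connEvent_eq_cylinder_embed x r hr hx EC hEC hrEC hcarry i₁ i₂ i₃)

/-- **`a₁` in an arbitrary graph hanging at the cycle vertex `x i₁`** (`a₂, a₃` on the cycle, `o` beyond
the cut). -/
theorem cd_of_cycle_root (p : E → R) (hp : IsProbVec p) (x : Fin n → V) (r : Fin n → E)
    (hr : ∀ i, ends (r i) = s(x i, x (i + 1))) (hx : Function.Injective x) (EC : Set E)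
    [DecidablePred (· ∈ EC)] (hEC : ∀ e, e ∈ EC → ∃ k, e = r k) (hrEC : ∀ k, r k ∈ EC)
    (hcarry : ∀ ω : Config E, ∀ i j : Fin n, Conn ends ω (x i) (x j) →
      Conn ends (restrict EC ω) (x i) (x j)) (i₁ i₂ i₃ : Fin n)
    (h : CutV.IsCut ends (x i₁) VA VB EA EB) {a₁ o : V} (ha₁ : a₁ ∈ VA ∪ {x i₁})
    (hi₂ : x i₂ ∈ VB) (ho : o ∈ VB) (hi₃ : x i₃ ∈ VB ∪ {x i₁}) {𝓔 : Set (Set V)}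
    (h𝓔 : IsUpperSet 𝓔) :
    let Q := (connEvent ends a₁ (x i₂))ᶜ
    let U := clusterInEvent ends a₁ 𝓔
    let e := connEvent ends a₁ (x i₃)
    let f := connEvent ends (x i₂) o
    let N := (connEvent ends a₁ (x i₃))ᶜ ∩ (connEvent ends (x i₂) (x i₃))ᶜ
    let oU := connEvent ends a₁ o ∪ connEvent ends (x i₂) o
    prob p (Q ∩ N) * (prob p Q * prob p (Q ∩ U ∩ e ∩ f) - prob p (Q ∩ U) * prob p (Q ∩ e ∩ f)) ≤
      prob p (Q ∩ N ∩ oU) * (prob p Q * prob p (Q ∩ U ∩ e) - prob p (Q ∩ U) * prob p (Q ∩ e)) :=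
  CDCutAC.cd_of_cut_root p hp h ha₁ hi₂ ho hi₃ h𝓔 fun _ h𝓤 =>
    CDCycle.required_anticorr_of_cylinder_Q _ (CDCutVertex.isProbVec_zeroOff hp EB) ends (x i₁)
      (x i₂) (x i₃) o h𝓤 (Q_inter_connEvent_eq_cylinder_embed x r hr hx EC hEC hrEC hcarry i₁ i₂ i₃)

/-- **`a₁` in an arbitrary graph hanging at `x i₁` AND `a₃` in an arbitrary graph hanging at `x i₃`**
(`a₂` on the cycle, `o` beyond the first cut and on the near side of the second). -/
theorem cd_of_cycle_both (p : E → R) (hp : IsProbVec p) (x : Fin n → V) (r : Fin n → E)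
    (hr : ∀ i, ends (r i) = s(x i, x (i + 1))) (hx : Function.Injective x) (EC : Set E)
    [DecidablePred (· ∈ EC)] (hEC : ∀ e, e ∈ EC → ∃ k, e = r k) (hrEC : ∀ k, r k ∈ EC)
    (hcarry : ∀ ω : Config E, ∀ i j : Fin n, Conn ends ω (x i) (x j) →
      Conn ends (restrict EC ω) (x i) (x j)) (i₁ i₂ i₃ : Fin n)
    (h : CutV.IsCut ends (x i₁) VA VB EA EB) {VA' VB' : Set V} {EA' EB' : Set E}
    [DecidablePred (· ∈ EA')] [DecidablePred (· ∈ EB')] (h' : CutV.IsCut ends (x i₃) VA' VB' EA' EB')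
    {a₁ a₃ o : V} (ha₁ : a₁ ∈ VA ∪ {x i₁}) (hi₂ : x i₂ ∈ VB) (ho : o ∈ VB) (ha₃ : a₃ ∈ VB)
    (hi₁' : x i₁ ∈ VA' ∪ {x i₃}) (hi₂' : x i₂ ∈ VA' ∪ {x i₃}) (ho' : o ∈ VA' ∪ {x i₃})
    (ha₃' : a₃ ∈ VB') {𝓔 : Set (Set V)} (h𝓔 : IsUpperSet 𝓔) :
    let Q := (connEvent ends a₁ (x i₂))ᶜ
    let U := clusterInEvent ends a₁ 𝓔
    let e := connEvent ends a₁ a₃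
    let f := connEvent ends (x i₂) o
    let N := (connEvent ends a₁ a₃)ᶜ ∩ (connEvent ends (x i₂) a₃)ᶜ
    let oU := connEvent ends a₁ o ∪ connEvent ends (x i₂) o
    prob p (Q ∩ N) * (prob p Q * prob p (Q ∩ U ∩ e ∩ f) - prob p (Q ∩ U) * prob p (Q ∩ e ∩ f)) ≤
      prob p (Q ∩ N ∩ oU) * (prob p Q * prob p (Q ∩ U ∩ e) - prob p (Q ∩ U) * prob p (Q ∩ e)) :=
  CDCutAC.cd_of_cut_root p hp h ha₁ hi₂ ho (Or.inl ha₃) h𝓔 fun _ h𝓤 =>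
    CDCutAC.required_anticorr_of_cut_far _ (CDCutVertex.isProbVec_zeroOff hp EB) h' hi₁' hi₂' ho'
      ha₃' h𝓤 fun _ h𝓤' =>
        CDCycle.required_anticorr_of_cylinder_Q _
          (CDCutVertex.isProbVec_zeroOff (CDCutVertex.isProbVec_zeroOff hp EB) EA') ends (x i₁)
          (x i₂) (x i₃) o h𝓤'
          (Q_inter_connEvent_eq_cylinder_embed x r hr hx EC hEC hrEC hcarry i₁ i₂ i₃)

end Theorems

end CDCyclePockets

end Summit.Ventures.PercRepro2
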